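import Literature.MathematicalPhysics.QuantumFieldTheory.CurvatureGaussianField
import Literature.Probability.LatticeModels.LatticeDirichletEnergy
import HarnessLib

/-!
# Stub `stub_kernelFixesExact` of line `Sketch` (crux `stmt-QuantumFields-8760`)

Route `EquipartitionCriticality` of `YangMills`, crux item `stmt-QuantumFields-8760`
(`Summit.QuantumFields.YangMills.Theses.EquipartitionCriticality.EquipartitionPinsProbe`), line
`Sketch`.

What is proved: the two-plaquette kernel `T(q, p) = curvatureTwoPoint q p` of the lattice Maxwell
(curvature) Gaussian field on `ℤ⁴` reproduces finitely supported *exact* `2`-cochains: if the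
`1`-cochain `α` is supported in the finite edge set `E` and its curl `dα = plaquetteCurl α` is
supported in the finite plaquette set `S`, then for every plaquette `p`,
`∑_{q ∈ S} (dα)_q T(q, p) = (dα)_p`.

Proof, written for general `d ≥ 3` in namespace `KernelFixesExact`:
* `plaquetteCurl_indicator`: the incidence numbers `[q : (x, i)] = (d δ_{(x,i)})_q` are `+1` on
  `(x; i,j)`, `(x − eⱼ; j,i)`, `−1` on `(x − eⱼ; i,j)`, `(x; j,i)` and `0` elsewhere;
* `sum_plaquetteCurl_indicator_mul`: hence, for every finite set `Q` of plaquettes containing the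
  (at most `2(d − 1)`) plaquettes through `(x, i)`, `∑_{q ∈ Q} [q : (x, i)] Y q = (d*Y)(x, i)`
  (adjointness of `d` and `d*`);
* `sum_indicatorCurl_mul_curvatureTwoPoint`: `∑_{q ∈ Q} [q : e] T(q, p) = [p : e]`, i.e.
  `d* T(·, p) = d* δ_p` — the identity of stub K1 (`stub_kernelExact`, file
  `…EquipartitionPinsProbeKernelExact.lean`), whose argument (`T(·, p) = dψ`, the `1`-form Hodge
  identity `d* d = −Δ + d D`, `D ψ = 0`, and the Poisson identity for `latticeGreen`) is re-run here
  so that this module only imports `Literature`;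
* `plaquetteCurl_eq_sum_of_support`: `(dα)_q = ∑_{e ∈ E} α e [q : e]` (linearity over the edges);
* `sum_plaquetteCurl_mul_eq_of_indicator`: enlarge `S` to `S ∪ plaquettesTouching E` (the summand
  vanishes off `S`), expand `(dα)_q`, swap the two finite sums, apply the reproduction of `d δ_e`
  edge by edge, and re-sum.
-/

noncomputable section

open Literature.MathematicalPhysics.QuantumFieldTheory Literature.MathematicalPhysics.QuantumLattice
  Literature.Probability.LatticeModels

namespace Summit.QuantumFields.YangMills.Theorems.EquipartitionPinsProbe

namespace KernelFixesExact

variable {d : ℕ}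

/-- **Incidence numbers.** For an edge `(x, i)` and a plaquette `q` of `ℤ^d`, the curl at `q` of
the indicator `1`-cochain of `(x, i)` (the incidence number `[q : (x, i)] ∈ {0, ±1}`) is `+1` on the
plaquettes `(x; i,j)` (`j > i`) and `(x − eⱼ; j,i)` (`j < i`), `−1` on `(x − eⱼ; i,j)` (`j > i`) and
`(x; j,i)` (`j < i`), and `0` elsewhere. -/
theorem plaquetteCurl_indicator (x : Site d) (i : Fin d) (q : ZdPlaquette d) :
    plaquetteCurl (fun e => if e = (x, i) then (1 : ℝ) else 0) q =
      ∑ j : Fin d,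
        if hij : i < j then
          ((if q = (x, ⟨(i, j), hij⟩) then (1 : ℝ) else 0) -
            (if q = (x - Pi.single j 1, ⟨(i, j), hij⟩) then (1 : ℝ) else 0))
        else if hji : j < i then
          ((if q = (x - Pi.single j 1, ⟨(j, i), hji⟩) then (1 : ℝ) else 0) -
            (if q = (x, ⟨(j, i), hji⟩) then (1 : ℝ) else 0))
        else 0 := by
  obtain ⟨y, ⟨a, b⟩, hab⟩ := q
  replace hab : a < b := hab
  rw [Fintype.sum_eq_add a b (ne_of_lt hab)]
  · simp only [plaquetteCurl_eq, Prod.mk.injEq, Subtype.mk.injEq]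
    by_cases hai : a = i
    · subst hai
      simp [hab, hab.ne', eq_sub_iff_add_eq]
    · by_cases hbi : b = i
      · subst hbi
        simp [hab, hab.ne, lt_asymm hab, eq_sub_iff_add_eq]
      · simp [hai, hbi]
  · rintro c ⟨hca, hcb⟩
    by_cases hic : i < c
    · rw [dif_pos hic]
      simp [hcb.symm]
    · rw [dif_neg hic]
      by_cases hci : c < i
      · rw [dif_pos hci]
        simp [hca.symm]
      · rw [dif_neg hci]

/-- **Adjointness of `d` and `d*` against the indicator of an edge.** For an edge `(x, i)`, a
`2`-cochain `Y` and a finite set `Q` of plaquettes containing every plaquette with `(x, i)` on its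
boundary, `∑_{q ∈ Q} [q : (x, i)] · Y q` is the co-derivative
`(d*Y)(x, i) = ∑_{j>i} (Y(x; i,j) − Y(x−eⱼ; i,j)) + ∑_{j<i} (Y(x−eⱼ; j,i) − Y(x; j,i))`. -/
theorem sum_plaquetteCurl_indicator_mul (x : Site d) (i : Fin d) (Y : ZdPlaquette d → ℝ)
    (Q : Finset (ZdPlaquette d)) (hQ : ∀ q : ZdPlaquette d, (x, i) ∈ plaquetteEdges q → q ∈ Q) :
    ∑ q ∈ Q, plaquetteCurl (fun e => if e = (x, i) then (1 : ℝ) else 0) q * Y q =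
      ∑ j : Fin d,
        if hij : i < j then (Y (x, ⟨(i, j), hij⟩) - Y (x - Pi.single j 1, ⟨(i, j), hij⟩))
        else if hji : j < i then (Y (x - Pi.single j 1, ⟨(j, i), hji⟩) - Y (x, ⟨(j, i), hji⟩))
        else 0 := by
  simp_rw [plaquetteCurl_indicator, Finset.sum_mul]
  rw [Finset.sum_comm]
  refine Finset.sum_congr rfl fun j _ => ?_
  by_cases hij : i < j
  · simp_rw [dif_pos hij, sub_mul, ite_mul, one_mul, zero_mul, Finset.sum_sub_distrib,
      Finset.sum_ite_eq']
    rw [if_pos (hQ (x, ⟨(i, j), hij⟩) (by simp [plaquetteEdges])),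
      if_pos (hQ (x - Pi.single j 1, ⟨(i, j), hij⟩) (by simp [plaquetteEdges]))]
  · by_cases hji : j < i
    · simp_rw [dif_neg hij, dif_pos hji, sub_mul, ite_mul, one_mul, zero_mul,
        Finset.sum_sub_distrib, Finset.sum_ite_eq']
      rw [if_pos (hQ (x - Pi.single j 1, ⟨(j, i), hji⟩) (by simp [plaquetteEdges])),
        if_pos (hQ (x, ⟨(j, i), hji⟩) (by simp [plaquetteEdges]))]
    · simp [hij, hji]

/-- **Linearity of the curl over a support.** A `1`-cochain `α` vanishing off the finite edge set
`E` is `∑_{e ∈ E} α e · δ_e`, so its curl is `(dα)_q = ∑_{e ∈ E} α e · [q : e]`. -/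
theorem plaquetteCurl_eq_sum_of_support (E : Finset (ZdEdge d)) (α : ZdEdge d → ℝ)
    (hα : ∀ e, e ∉ E → α e = 0) (q : ZdPlaquette d) :
    plaquetteCurl α q =
      ∑ e ∈ E, α e * plaquetteCurl (fun e' => if e' = e then (1 : ℝ) else 0) q := by
  have h : ∀ f : ZdEdge d, ∑ e ∈ E, α e * (if f = e then (1 : ℝ) else 0) = α f := by
    intro f
    simp_rw [mul_ite, mul_one, mul_zero]
    rw [Finset.sum_ite_eq]
    split_ifs with hf
    · rfl
    · exact (hα f hf).symm
  symm
  calc ∑ e ∈ E, α e * plaquetteCurl (fun e' => if e' = e then (1 : ℝ) else 0) q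
      = ∑ e ∈ E, ∑ m : Fin 4, plaquetteBoundarySign m *
          (α e * (if plaquetteBoundary q m = e then (1 : ℝ) else 0)) := by
        refine Finset.sum_congr rfl fun e _ => ?_
        rw [plaquetteCurl, Finset.mul_sum]
        refine Finset.sum_congr rfl fun m _ => ?_
        ring
    _ = ∑ m : Fin 4, plaquetteBoundarySign m * α (plaquetteBoundary q m) := by
        rw [Finset.sum_comm]
        refine Finset.sum_congr rfl fun m _ => ?_
        rw [← Finset.mul_sum, h]
    _ = plaquetteCurl α q := rfl

/-- **`d* T = d*` for the curvature kernel, adjoint form: `T` reproduces the elementary exact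
`2`-cochains `d δ_e`.** For `d ≥ 3`, an edge `(x, i)`, a finite set `Q` of plaquettes containing
every plaquette through `(x, i)`, and a plaquette `p`,
`∑_{q ∈ Q} [q : (x, i)] T(q, p) = [p : (x, i)]` with `T = curvatureTwoPoint`. By adjointness
(`sum_plaquetteCurl_indicator_mul`) the left side is the co-derivative `(d* T(·, p))(x, i)`, which
is computed as in stub K1 (`stub_kernelExact`, file `…EquipartitionPinsProbeKernelExact.lean`, whose
argument is re-run here so that this module does not import that one): `T(·, p) = dψ` with
`ψ e = plaquetteCurl (edgeGreen e ·) p` (`curvatureTwoPoint_eq_plaquetteCurl`); the `1`-form Hodge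
identity `d* d = −Δ + d D` (pure algebra); the divergence `D ψ` vanishes (the eight Green terms
telescope); and `−Δ ψ(·, i)(x) = [p : (x, i)]` by the Poisson identity
`neg_latticeLaplacianZd_half_latticeGreen_sub`. -/
theorem sum_indicatorCurl_mul_curvatureTwoPoint (hd : 3 ≤ d) (x : Site d) (i : Fin d)
    (Q : Finset (ZdPlaquette d)) (hQ : ∀ q : ZdPlaquette d, (x, i) ∈ plaquetteEdges q → q ∈ Q)
    (p : ZdPlaquette d) :
    ∑ q ∈ Q, plaquetteCurl (fun e => if e = (x, i) then (1 : ℝ) else 0) q * curvatureTwoPoint q p =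
      plaquetteCurl (fun e => if e = (x, i) then (1 : ℝ) else 0) p := by
  rw [sum_plaquetteCurl_indicator_mul x i (fun q => curvatureTwoPoint q p) Q hQ]
  -- the `j`-th summand of `(d* dA)(x, i)`, for every `1`-cochain `A`
  have hsummand : ∀ (A : ZdEdge d → ℝ) (j : Fin d),
      (if hij : i < j then
          (plaquetteCurl A (x, ⟨(i, j), hij⟩) - plaquetteCurl A (x - Pi.single j 1, ⟨(i, j), hij⟩))
        else if hji : j < i then
          (plaquetteCurl A (x - Pi.single j 1, ⟨(j, i), hji⟩) - plaquetteCurl A (x, ⟨(j, i), hji⟩))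
        else 0) =
        (2 * A (x, i) - A (x + Pi.single j 1, i) - A (x - Pi.single j 1, i)) +
          ((A (x + Pi.single i 1, j) - A (x + Pi.single i 1 - Pi.single j 1, j)) -
            (A (x, j) - A (x - Pi.single j 1, j))) := by
    intro A j
    have h1 : x - Pi.single j 1 + Pi.single j 1 = x := sub_add_cancel x _
    have h2 : x - Pi.single j 1 + Pi.single i 1 = x + Pi.single i 1 - Pi.single j 1 :=
      sub_add_eq_add_sub x _ _
    split_ifs with hij hji
    · simp only [plaquetteCurl_eq, h1, h2]
      ring
    · simp only [plaquetteCurl_eq, h1, h2]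
      ring
    · obtain rfl : i = j := le_antisymm (not_lt.1 hji) (not_lt.1 hij)
      rw [add_sub_cancel_right]
      ring
  -- the `1`-form Hodge identity `(d* dA)(x, i) = −Δ(A(·, i))(x) + (D A (x + eᵢ) − D A x)`
  have hhodge : ∀ A : ZdEdge d → ℝ,
      (∑ j : Fin d,
        if hij : i < j then
          (plaquetteCurl A (x, ⟨(i, j), hij⟩) - plaquetteCurl A (x - Pi.single j 1, ⟨(i, j), hij⟩))
        else if hji : j < i then
          (plaquetteCurl A (x - Pi.single j 1, ⟨(j, i), hji⟩) - plaquetteCurl A (x, ⟨(j, i), hji⟩))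
        else 0) =
        -latticeLaplacianZd (fun z => A (z, i)) x +
          ((∑ j : Fin d, (A (x + Pi.single i 1, j) - A (x + Pi.single i 1 - Pi.single j 1, j))) -
            ∑ j : Fin d, (A (x, j) - A (x - Pi.single j 1, j))) := by
    intro A
    simp only [hsummand]
    simp only [Finset.sum_add_distrib, Finset.sum_sub_distrib, Finset.sum_const, Finset.card_univ,
      Fintype.card_fin, nsmul_eq_mul, latticeLaplacianZd]
    ring
  -- the divergence of `ψ = Γ d* δ_p` vanishes identically
  have hdiv : ∀ y : Site d,
      ∑ j : Fin d, (plaquetteCurl (fun f => edgeGreen (y, j) f) p -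
        plaquetteCurl (fun f => edgeGreen (y - Pi.single j 1, j) f) p) = 0 := by
    intro y
    obtain ⟨w, ⟨a, b⟩, _⟩ := p
    simp only [plaquetteCurl_eq, edgeGreen_apply, Finset.sum_sub_distrib, Finset.sum_add_distrib,
      Finset.sum_ite_eq', Finset.mem_univ, if_true]
    rw [show y - (w + Pi.single a 1) = y - Pi.single a 1 - w by abel,
      show y - (w + Pi.single b 1) = y - Pi.single b 1 - w by abel,
      show y - Pi.single b 1 - (w + Pi.single a 1) = y - Pi.single a 1 - (w + Pi.single b 1) by
        abel]
    ring
  -- `−Δ` of the edge Green kernel is the identity kernel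
  have hgreen : ∀ f : ZdEdge d,
      -latticeLaplacianZd (fun z => edgeGreen (z, i) f) x = if f = (x, i) then 1 else 0 := by
    rintro ⟨y, k⟩
    by_cases hik : i = k
    · subst hik
      have h : (fun z : Site d => edgeGreen (z, i) (y, i)) = fun z => latticeGreen (z - y) / 2 := by
        funext z
        simp [edgeGreen]
      rw [h, neg_latticeLaplacianZd_half_latticeGreen_sub d hd y x]
      by_cases hxy : x = y
      · subst hxy
        simp
      · rw [if_neg hxy, if_neg]
        simp only [Prod.mk.injEq, and_true]
        exact Ne.symm hxy
    · have h : (fun z : Site d => edgeGreen (z, i) (y, k)) = fun _ => (0 : ℝ) := by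
        funext z
        simp [edgeGreen, hik]
      rw [h, latticeLaplacianZd_const, neg_zero, if_neg]
      simp only [Prod.mk.injEq, not_and]
      exact fun _ hki => hik hki.symm
  -- `−Δ ψ(·, i)(x) = [p : (x, i)]`
  have hlap : -latticeLaplacianZd (fun z => plaquetteCurl (fun f => edgeGreen (z, i) f) p) x =
      plaquetteCurl (fun e => if e = (x, i) then (1 : ℝ) else 0) p := by
    have hcomm : latticeLaplacianZd (fun z => plaquetteCurl (fun f => edgeGreen (z, i) f) p) x =
        plaquetteCurl (fun e => latticeLaplacianZd (fun z => edgeGreen (z, i) e) x) p := by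
      simp only [plaquetteCurl_eq, latticeLaplacianZd, Finset.sum_add_distrib,
        Finset.sum_sub_distrib]
      ring
    rw [hcomm]
    simp only [← hgreen, plaquetteCurl_eq]
    ring
  simp only [curvatureTwoPoint_eq_plaquetteCurl]
  rw [hhodge, hdiv, hdiv, sub_self, add_zero]
  exact hlap

/-- **A kernel reproducing the elementary exact `2`-cochains reproduces all finitely supported
exact `2`-cochains.** If a two-plaquette kernel `T` on `ℤ^d` satisfies
`∑_{q ∈ Q} [q : e] T(q, p) = [p : e]` for every edge `e`, every finite `Q` containing the plaquettes
through `e` and every plaquette `p`, then for every `1`-cochain `α` supported in the finite edge set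
`E` whose curl `dα` is supported in the finite plaquette set `S`,
`∑_{q ∈ S} (dα)_q T(q, p) = (dα)_p` for every plaquette `p`. -/
theorem sum_plaquetteCurl_mul_eq_of_indicator (T : ZdPlaquette d → ZdPlaquette d → ℝ)
    (hT : ∀ (x : Site d) (i : Fin d) (Q : Finset (ZdPlaquette d)),
      (∀ q : ZdPlaquette d, (x, i) ∈ plaquetteEdges q → q ∈ Q) → ∀ p : ZdPlaquette d,
        ∑ q ∈ Q, plaquetteCurl (fun e => if e = (x, i) then (1 : ℝ) else 0) q * T q p =
          plaquetteCurl (fun e => if e = (x, i) then (1 : ℝ) else 0) p)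
    (S : Finset (ZdPlaquette d)) (E : Finset (ZdEdge d)) (α : ZdEdge d → ℝ)
    (hα : ∀ e, e ∉ E → α e = 0) (hS : ∀ p, p ∉ S → plaquetteCurl α p = 0) (p : ZdPlaquette d) :
    ∑ q ∈ S, plaquetteCurl α q * T q p = plaquetteCurl α p := by
  have hSQ : ∑ q ∈ S, plaquetteCurl α q * T q p =
      ∑ q ∈ S ∪ plaquettesTouching E, plaquetteCurl α q * T q p := by
    refine Finset.sum_subset Finset.subset_union_left fun q _ hqS => ?_
    rw [hS q hqS, zero_mul]
  have hQ : ∀ e ∈ E, ∀ q : ZdPlaquette d, e ∈ plaquetteEdges q → q ∈ S ∪ plaquettesTouching E :=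
    fun e he q hq =>
      Finset.mem_union_right _ (mem_plaquettesTouching_iff.2 ⟨e, Finset.mem_inter.2 ⟨hq, he⟩⟩)
  rw [hSQ, plaquetteCurl_eq_sum_of_support E α hα p]
  simp_rw [plaquetteCurl_eq_sum_of_support E α hα, Finset.sum_mul]
  rw [Finset.sum_comm]
  refine Finset.sum_congr rfl fun e he => ?_
  simp_rw [mul_assoc]
  rw [← Finset.mul_sum]
  congr 1
  obtain ⟨x, i⟩ := e
  exact hT x i _ (hQ _ he) p

end KernelFixesExact

/-- STUB R2 — **the curvature kernel reproduces finitely supported exact forms** (`T dα = dα`):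
for a `1`-cochain `α` on the edges of `ℤ⁴` supported in the finite set `E`, whose curl
`dα = plaquetteCurl α` is supported in the finite plaquette set `S`, and every plaquette `p`,
`∑_{q ∈ S} (dα)_q T(q, p) = (dα)_p` with `T = curvatureTwoPoint` (linearity over the edges of
`d* T = d*`, the identity of STUB K1 in its adjoint form
`KernelFixesExact.sum_indicatorCurl_mul_curvatureTwoPoint`, assembled by
`KernelFixesExact.sum_plaquetteCurl_mul_eq_of_indicator`; the sum over `S ⊇ supp dα` equals the
sum over `S ∪ plaquettesTouching E` because the summand vanishes off `S`). -/
theorem stub_kernelFixesExact :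
    ∀ (S : Finset (Literature.MathematicalPhysics.QuantumLattice.ZdPlaquette 4))
        (E : Finset (Literature.MathematicalPhysics.QuantumLattice.ZdEdge 4))
        (α : Literature.MathematicalPhysics.QuantumLattice.ZdEdge 4 → ℝ),
      (∀ e, e ∉ E → α e = 0) →
      (∀ p, p ∉ S → Literature.MathematicalPhysics.QuantumFieldTheory.plaquetteCurl α p = 0) →
      ∀ p : Literature.MathematicalPhysics.QuantumLattice.ZdPlaquette 4,
        ∑ q ∈ S, Literature.MathematicalPhysics.QuantumFieldTheory.plaquetteCurl α q *
            Literature.MathematicalPhysics.QuantumFieldTheory.curvatureTwoPoint q p =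
          Literature.MathematicalPhysics.QuantumFieldTheory.plaquetteCurl α p :=
  fun S E α hα hS p =>
    KernelFixesExact.sum_plaquetteCurl_mul_eq_of_indicator curvatureTwoPoint
      (fun x i Q hQ p =>
        KernelFixesExact.sum_indicatorCurl_mul_curvatureTwoPoint (by norm_num) x i Q hQ p)
      S E α hα hS p

end Summit.QuantumFields.YangMills.Theorems.EquipartitionPinsProbe

end
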